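import Literature.AlgebraicGeometry.Motives.ComplexPointsEtaleLocalHomeomorph
import Literature.AlgebraicGeometry.Motives.ComplexPointsEhresmann
import HarnessLib

/-!
# `φ(ℂ)` is a local homeomorphism at the complex points of an open subscheme where `φ` is smooth

Stub `stub_localHomeomorph_of_smooth` of the line `andre_motivated_split` for the crux
`HodgeBeyondAnchors` (stmt-HodgeConjecture-14054), ingredient (E) of the cone step of Chow's moving
lemma read in singular cohomology: for a morphism `φ : X ⟶ Y` of smooth projective complex `n`-folds
and a Zariski-open `U ⊆ X` on which `φ` is smooth (hence étale, the relative dimensions being equal),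
the map of complex points `φ(ℂ) : X(ℂ) → Y(ℂ)` agrees near every complex point `P` of `U` with an
open partial homeomorphism `X(ℂ) ⇀ Y(ℂ)` (SGA 1, Exp. XII, Prop. 3.1 (iii): `f` étale ⇔ `f^an` a local
isomorphism; Serre, GAGA §2 n°5).

The tree has the case `U = X`: `ComplexPoints.exists_openPartialHomeomorph_eqOn_map`
(`Motives/ComplexPointsEtaleLocalHomeomorph`). The proof here is its transport along the open
subscheme: `U`, as the `ℂ`-scheme `openSubschemeOver X U`, is locally of finite type and smooth of
relative dimension `n` over `ℂ` (an open immersion is smooth of relative dimension `0`), the tree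
theorem applies to `φ|_U : U ⟶ Y` at a lift `P'` of `P`
(`AlgPoints.range_map_of_isOpenImmersion_holds`), and the resulting partial homeomorphism
`U(ℂ) ⇀ Y(ℂ)` is pre-composed with the inverse of the open embedding `U(ℂ) ↪ X(ℂ)`
(`AlgPoints.isOpenEmbedding_map_holds`, Mathlib `IsOpenEmbedding.toOpenPartialHomeomorph`).

## References

* [SGA1] A. Grothendieck, M. Raynaud, SGA 1, Exp. XII, Prop. 3.1 (iii) and Thm. 1.1, proof a).
* [SerreGAGA1956] J.-P. Serre, Géométrie algébrique et géométrie analytique, Ann. Inst. Fourier 6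
  (1956), §2 n°5.
-/

set_option linter.dupNamespace false

noncomputable section

open CategoryTheory AlgebraicGeometry Set Topology
open Literature.AlgebraicGeometry.Motives Literature.AlgebraicGeometry.HodgeTheory

namespace Summit.HodgeConjecture.HodgeConjecture.Theorems.HodgeBeyondAnchors

/-- **`φ(ℂ)` is a local homeomorphism at the complex points of an open subscheme on which `φ` is
smooth** (SGA 1 XII Prop. 3.1 (iii): `f` étale ⇔ `f^an` a local isomorphism; Serre GAGA §2 n°5).
For `φ : X ⟶ Y` between smooth projective complex `n`-folds and an open `U ⊆ X` with `φ|_U` smooth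
(hence étale), at every complex point `P` of `U` the map of complex points `φ(ℂ)` agrees near `P`
with an open partial homeomorphism `X(ℂ) ⇀ Y(ℂ)`: the tree's
`ComplexPoints.exists_openPartialHomeomorph_eqOn_map n` for `φ|_U : U ⟶ Y` (the open subscheme
`openSubschemeOver X U` is smooth of relative dimension `n` and locally of finite type over `ℂ`),
transported along the open embedding `U(ℂ) ↪ X(ℂ)` (`AlgPoints.isOpenEmbedding_map_holds`,
`AlgPoints.range_map_of_isOpenImmersion_holds`, `AlgPoints.map_comp_apply`).
[cite: SGA1, Exp. XII Prop. 3.1 (iii)] [cite: SerreGAGA1956, §2 n°5 (p. 9)] -/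
theorem stub_localHomeomorph_of_smooth :
    ∀ ⦃n : ℕ⦄ ⦃X Y : SchemeOver ℂ⦄, IsSmoothProjective n X → IsSmoothProjective n Y →
      ∀ (φ : X ⟶ Y) (U : X.left.Opens), Smooth (U.ι ≫ φ.left) →
        ∀ P : ComplexPoints X, P.pt ∈ U →
          ∃ e : OpenPartialHomeomorph (ComplexPoints X) (ComplexPoints Y),
            P ∈ e.source ∧ Set.EqOn (AlgPoints.map φ) e e.source := by
  intro n X Y hX hY φ U hU P hPU
  -- instances on `X`, `Y`
  haveI : SmoothOfRelativeDimension n X.hom := hX.smoothOfRelativeDimension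
  haveI : SmoothOfRelativeDimension n Y.hom := hY.smoothOfRelativeDimension
  haveI : LocallyOfFiniteType X.hom := by
    haveI : Smooth X.hom := SmoothOfRelativeDimension.smooth n _
    infer_instance
  haveI : LocallyOfFiniteType Y.hom := by
    haveI : Smooth Y.hom := SmoothOfRelativeDimension.smooth n _
    infer_instance
  -- the open subscheme `U` over `ℂ`, its open immersion `ι : U ⟶ X` and `φ' := φ|_U : U ⟶ Y`
  set X' := openSubschemeOver X U with hX'
  set ι := openSubschemeOverι X U with hι
  haveI : IsOpenImmersion ι.left := inferInstanceAs (IsOpenImmersion U.ι)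
  haveI : LocallyOfFiniteType X'.hom := inferInstanceAs (LocallyOfFiniteType (U.ι ≫ X.hom))
  haveI : SmoothOfRelativeDimension n X'.hom := by
    have h : SmoothOfRelativeDimension (0 + n) (U.ι ≫ X.hom) := inferInstance
    rw [Nat.zero_add] at h
    exact h
  set φ' : X' ⟶ Y := Over.homMk (U.ι ≫ φ.left) (by
    change (U.ι ≫ φ.left) ≫ Y.hom = U.ι ≫ X.hom
    rw [Category.assoc, Over.w φ]) with hφ'
  haveI : Smooth φ'.left := hU
  have hιφ : ι ≫ φ = φ' := by
    ext1
    rfl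
  -- lift `P` to `P' ∈ U(ℂ)`
  have hPr : P ∈ Set.range (AlgPoints.map ι : ComplexPoints X' → ComplexPoints X) := by
    rw [AlgPoints.range_map_of_isOpenImmersion_holds ι]
    change P.pt ∈ (U.ι.opensRange : Set X.left)
    rw [Scheme.Opens.opensRange_ι]
    exact hPU
  obtain ⟨P', rfl⟩ := hPr
  haveI : Nonempty (ComplexPoints X') := ⟨P'⟩
  -- the tree theorem on `U ⟶ Y`, transported along the open embedding `U(ℂ) ↪ X(ℂ)`
  obtain ⟨e', hP'e', he'⟩ := ComplexPoints.exists_openPartialHomeomorph_eqOn_map n φ' P'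
  have hιe : IsOpenEmbedding (AlgPoints.map ι : ComplexPoints X' → ComplexPoints X) :=
    AlgPoints.isOpenEmbedding_map_holds ι
  set j := hιe.toOpenPartialHomeomorph (AlgPoints.map ι) with hj
  refine ⟨j.symm.trans e', ?_, ?_⟩
  · rw [OpenPartialHomeomorph.trans_source, OpenPartialHomeomorph.symm_source]
    refine ⟨?_, ?_⟩
    · rw [hj, IsOpenEmbedding.toOpenPartialHomeomorph_target]
      exact ⟨P', rfl⟩
    · change j.symm (AlgPoints.map ι P') ∈ e'.source
      rw [hj, hιe.toOpenPartialHomeomorph_left_inv]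
      exact hP'e'
  · intro Q hQ
    rw [OpenPartialHomeomorph.trans_source, OpenPartialHomeomorph.symm_source] at hQ
    obtain ⟨hQ1, hQ2⟩ := hQ
    rw [hj, IsOpenEmbedding.toOpenPartialHomeomorph_target] at hQ1
    obtain ⟨Q', rfl⟩ := hQ1
    have hQ2' : j.symm (AlgPoints.map ι Q') ∈ e'.source := hQ2
    change AlgPoints.map φ (AlgPoints.map ι Q') = e' (j.symm (AlgPoints.map ι Q'))
    rw [hj, hιe.toOpenPartialHomeomorph_left_inv] at hQ2' ⊢
    rw [← he' hQ2', ← AlgPoints.map_comp_apply, hιφ]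

end Summit.HodgeConjecture.HodgeConjecture.Theorems.HodgeBeyondAnchors

end
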